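import Summits.PneNP.PneNP.Theorems.ChebyshevTracialDesignJuntaContainmentAllDirections
import HarnessLib

/-!
# Cell pnp-psdrank, route `ChebyshevTracialDesign`: JUNTA MASKS TIMES LOW-DEGREE SQUARES — the whole (CG_d)-hierarchy on junta masks: for a
# nonnegative `J`-junta `f` and ANY `q` of Johnson degree `≤ d` (coefficient mass `Λ_α`, matching-adapted), per matching
# `Σ_U W(U,M)f(U)q(U)² ≤ |PM|⁻¹·B_v·C(T,D+1)·Λ_α²Λ_f·4^k·C(k,D+1)(D+1)!N^{k−D−1}/[N]_k`, `k = |J|+2d`, and summed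
# `Σ_M(·)₊ ≤ B_v·C(T,D+1)·Λ_α²Λ_f·8^kC(k,D+1)(D+1)!/N^{D+1}` (crux `TracialDecayExp20`, stmt-PneNP-19878)

Brick 114 (prover g20; MEMO-23 §2(e), generalising brick 113a/b from `q = C_v` to every low-degree square). MEMO-21 §3 organised the tightness-free
conditional-positivity programme as a hierarchy (CG_d): «`Σ_U W(U,M) f(U) q(U)² ≲ 0` for masks `f ∈ [0,1]` and cut functions `q` of Johnson degree `≤ d`»,
with (CG_1)/(CG_1') (`q` linear / `q = C_v`) the first rung above NTF. This file settles every rung for JUNTA masks: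
* §1 **`juntaTimesSquare_levelLaw`** — `t` odd, `2t+2 ≤ n`, `f ≥ 0` a `J`-junta `≤ Λ_f`, `q = Σ_{|A'|≤d} α_{A'}1[A' ⊆ ·]`, `k = |J|+2d`, `2k+1 ≤ t`: the
  level profile of `[U odd]·f q²` at `M` is ONE polynomial of degree `≤ k` with `P(0) ≥ 0` (`f = Σ_l g_l²` by brick 109 ⇒ `f q² = Σ_l (g_lq)²` of degree
  `≤ |J|+d`; Literature `lowdeg_sum_law_sharp`, Grigoriev) and `|P^{(m)}(ξ)| ≤ (Σ|α|)²Λ_f·4^k·C(k,m)m!N^{k−m}/[N]_k` on `[0,N]`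
  (`f q² = Σ_{A',A''} α_{A'}α_{A''}·f·1[A'∪A'' ⊆ U]`, nonnegative juntas of window `≤ k` edges, brick 110b, termwise; the two polynomials coincide by
  brick 113a `levelLaw_unique`).
* §2 **`juntaTimesSquare_le_single`** (per matching, via brick 113b `designValue_le_of_levelLaw`) and **`sum_posPart_juntaTimesSquare_le`** (summed over
  `M` with matching-adapted coefficients `α_M`, `Σ|α_M| ≤ Λ_α`; power form through brick 110c `pow_div_descFactorial_le`). In the balanced Chebyshev
  regime: `≈ 20Λ_α²Λ_f·8^k(8k/√n)^{dq n+1}` — super-polynomially small for `k = |J| + 2d = O(dq n)`.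
READING: with `d = 1` (`q = Σ_p g_px_p`) this is CG_1 of MEMO-21 §3(b) for junta masks, per matching, with the sup over `g` in an `ℓ¹`-ball inside; with
`q = C_v` it is (CG_1') (brick 113b, sharper window); the matrix/all-`r` statement for junta AMPLITUDES `X_U = f(U)·B_UB_Uᵀ` follows by writing
`tr(f B_UB_UᵀY_M)` as `f·Σ_s q_s²` (next brick). The open part of every (CG_d) is the non-junta mask.
[cite: Grigoriev2001, Lemma 1.4 (PDF p. 8)] [cite: Rothvoss2017, §2 (PDF p. 6)] [cite: SakaueEtAl2017, main theorem (as quoted in KurpiszLeppanenMastrolilli2016 §1 p. 3)]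
[cite: Agarwal2000DifferenceEquations, Remark 1.8.1 (1.8.8)] [cite: GriblingDelaatLaurent2019, §5]
Stature: support/instrument (kernel lane, no defs, axioms standard). WHAT THIS IS NOT: nothing on non-junta masks, no proof or refutation of
`TracialDecayExp20`, nothing on psd rank of P_PM(K_n), no P-vs-NP content. Supports stmt-PneNP-19878.
-/

set_option linter.dupNamespace false -- `Summit.PneNP.PneNP.…`: summit = sub-problem (D-0017)

noncomputable section

namespace Summit.PneNP.PneNP.Theorems.ChebyshevTracialDesignJuntaTimesSquare

open Finset Matrix Polynomial Literature.Barriers.PneNP Literature.Combinatorics.Optimization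
open Literature.Computability.Complexity (Grigoriev2001_knapsackFormNonneg_holds)
open Literature.Combinatorics.Optimization.ChebyshevTracialDesignJunta (lowdeg_sum_law_sharp)
open Summit.PneNP.PneNP.Theorems.ChebyshevTracialDesignJunta (card_eq_cr_add_two_mul_in two_mul_card_pmatch card_window_edges_le subset_verts_window)
open Summit.PneNP.PneNP.Theorems.ChebyshevTracialDesignJuntaRemainderPricing (junta_sum_law_smooth card_window_le)
open Summit.PneNP.PneNP.Theorems.ChebyshevTracialDesignJuntaRemainderRung (pow_div_descFactorial_le)
open Summit.PneNP.PneNP.Theorems.ChebyshevTracialDesignCutJuntaMasks (exists_sos_of_nonneg_junta)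
open Summit.PneNP.PneNP.Theorems.ChebyshevTracialDesignLowDegreeMasks (mul_mem_lowSpan)
open Summit.PneNP.PneNP.Theorems.ChebyshevTracialDesignJuntaTiltedProfile (levelLaw_unique)
open Summit.PneNP.PneNP.Theorems.ChebyshevTracialDesignJuntaContainmentAllDirections (designValue_le_of_levelLaw)

variable {n : ℕ}

/-! ### §1 The profile of a junta mask times a low-degree square -/

/-- **JUNTA MASK × LOW-DEGREE SQUARE: one profile polynomial, nonnegative at the virtual level and smooth.** Let `t` be odd with `2t+2 ≤ n`, `M` a
perfect matching, `f` a nonnegative `J`-junta mask `≤ Λ_f` on the odd cuts, and `q(U) = Σ_{|A'| ≤ d} α_{A'}·1[A' ⊆ U]` ANY cut function of Johnson degree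
`≤ d` given by coefficients `α` (signs arbitrary, `M`-dependence allowed), with `k := |J| + 2d`, `2k + 1 ≤ t`. Then there is ONE real polynomial `P` of
degree `≤ k` such that: the level sums of `[U odd]·f(U)q(U)²` at `M` are `T(N;c,i)·P(c)` (`c + 2i = t`, `N = n/2`); `P(0) ≥ 0` (`f = Σ_l g_l²`, brick 109,
so `f q² = Σ_l (g_l q)²` of Johnson degree `≤ |J| + d`: sharp half-degree law, Grigoriev); and for all `m`, `ξ ∈ [0,N]`:
`|P^{(m)}(ξ)| ≤ (Σ_{A'}|α_{A'}|)²·Λ_f·4^k·C(k,m)·m!·N^{k−m}/[N]_k` (`f q² = Σ_{A',A''} α_{A'}α_{A''}·f·1[A'∪A'' ⊆ U]`, nonnegative juntas of window `≤ k` edges,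
brick 110b termwise; `levelLaw_unique`). Brick 113a is the case `q = C_v` (`d = 2`, with the sharper window `|J|+2`).
[cite: Grigoriev2001, Lemma 1.4 (PDF p. 8)] [cite: Rothvoss2017, §2 (PDF p. 6)] [cite: SakaueEtAl2017, main theorem (as quoted in KurpiszLeppanenMastrolilli2016 §1 p. 3)] -/
theorem juntaTimesSquare_levelLaw (M : PMatch n) {t : ℕ} (ht : Odd t) (htn : 2 * t + 2 ≤ n) (J : Finset (Fin n)) {d : ℕ}
    (hJt : 2 * (J.card + 2 * d) + 1 ≤ t)
    (f : OddSet n → ℝ) (hf : ∀ U U' : OddSet n, U.1 ∩ J = U'.1 ∩ J → f U = f U') {Λf : ℝ} (hf0 : ∀ U, 0 ≤ f U) (hfΛ : ∀ U, f U ≤ Λf)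
    (α : {A' : Finset (Fin n) // A'.card ≤ d} → ℝ) :
    ∃ P : Polynomial ℝ, P.natDegree ≤ J.card + 2 * d ∧ 0 ≤ P.eval 0 ∧
      (∀ c i : ℕ, c + 2 * i = t →
        ∑ U ∈ (univ : Finset (Fin n)).powerset.filter (fun U =>
            (M.1.filter fun e => cutCount U e = 1).card = c ∧ (M.1.filter fun e => cutCount U e = 2).card = i),
          (if h : Odd U.card then f ⟨U, h⟩ * (∑ A' : {A' : Finset (Fin n) // A'.card ≤ d}, α A' * (if A'.1 ⊆ U then (1 : ℝ) else 0)) ^ 2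
            else 0) =
          (((n / 2).choose (c + i) * (c + i).choose i * 2 ^ c : ℕ) : ℝ) * P.eval (c : ℝ)) ∧
      ∀ (m : ℕ) (ξ : ℝ), 0 ≤ ξ → ξ ≤ ((n / 2 : ℕ) : ℝ) →
        |(derivative^[m] P).eval ξ| ≤ (∑ A', |α A'|) ^ 2 * Λf * (4 : ℝ) ^ (J.card + 2 * d) *
          ((((J.card + 2 * d).choose m : ℕ) : ℝ) * (m.factorial : ℝ) * (((n / 2 : ℕ) : ℝ)) ^ (J.card + 2 * d - m) /
            ((n / 2).descFactorial (J.card + 2 * d) : ℝ)) := by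
  classical
  set k := J.card + 2 * d with hk
  set N := n / 2 with hNdef
  have hN : M.1.card = N := by have := two_mul_card_pmatch M; omega
  have htN : t ≤ N := by omega
  have hΛf : 0 ≤ Λf := by
    have hodd1 : Odd (({(⟨0, by omega⟩ : Fin n)} : Finset (Fin n)).card) := by simp
    exact (hf0 ⟨_, hodd1⟩).trans (hfΛ ⟨_, hodd1⟩)
  -- abbreviations
  set ind : Finset (Fin n) → {A' : Finset (Fin n) // A'.card ≤ d} → ℝ := fun U A' => if A'.1 ⊆ U then (1 : ℝ) else 0 with hind
  set qF : Finset (Fin n) → ℝ := fun U => ∑ A', α A' * ind U A' with hqF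
  set G : Finset (Fin n) → ℝ := fun U => if h : Odd U.card then f ⟨U, h⟩ * qF U ^ 2 else 0 with hG
  set Gab : {A' : Finset (Fin n) // A'.card ≤ d} → {A' : Finset (Fin n) // A'.card ≤ d} → Finset (Fin n) → ℝ :=
    fun A' A'' U => if h : Odd U.card then f ⟨U, h⟩ * (ind U A' * ind U A'') else 0 with hGab
  have hGsum : ∀ U, G U = ∑ A', ∑ A'', α A' * α A'' * Gab A' A'' U := by
    intro U
    rw [hG, hGab]; dsimp only
    split_ifs with h
    · rw [hqF]; dsimp only
      rw [sq, sum_mul_sum, mul_sum]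
      refine sum_congr rfl fun A' _ => ?_
      rw [mul_sum]
      exact sum_congr rfl fun A'' _ => by ring
    · simp
  -- STEP A: the smooth profile from the pattern expansion
  have hpat : ∀ A' A'' : {A' : Finset (Fin n) // A'.card ≤ d}, ∃ P : Polynomial ℝ, P.natDegree ≤ k ∧ (∀ c i : ℕ, c + 2 * i = t →
      ∑ U ∈ (univ : Finset (Fin n)).powerset.filter (fun U =>
          (M.1.filter fun e => cutCount U e = 1).card = c ∧ (M.1.filter fun e => cutCount U e = 2).card = i), Gab A' A'' U =
        ((N.choose (c + i) * (c + i).choose i * 2 ^ c : ℕ) : ℝ) * P.eval (c : ℝ)) ∧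
      ∀ (m : ℕ) (ξ : ℝ), 0 ≤ ξ → ξ ≤ (N : ℝ) →
        |(derivative^[m] P).eval ξ| ≤ Λf * (4 : ℝ) ^ k *
          (((k.choose m : ℕ) : ℝ) * (m.factorial : ℝ) * (N : ℝ) ^ (k - m) / (N.descFactorial k : ℝ)) := by
    intro A' A''
    set A : Finset (Fin n) := J ∪ (A'.1 ∪ A''.1) with hA
    have hAcard : A.card ≤ k := by
      rw [hA, hk]
      refine (card_union_le _ _).trans ?_
      have h2 := card_union_le A'.1 A''.1
      have h3 := A'.2
      have h4 := A''.2
      omega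
    set E₀ := M.1.filter (fun e => ∃ a ∈ A, a ∈ e) with hE₀
    have hE₀M : E₀ ⊆ M.1 := filter_subset _ _
    have hE₀A : E₀.card ≤ k := (card_window_edges_le M A).trans hAcard
    obtain ⟨E, hE₀E, hEM, hEcard⟩ := exists_subsuperset_card_eq hE₀M hE₀A (by rw [hN]; omega)
    set W := (univ : Finset (Fin n)).filter (fun w => ∃ e ∈ E, w ∈ e) with hW
    have hAW : A ⊆ W := by
      intro a ha
      obtain ⟨e, he, hae⟩ := (mem_filter.1 (subset_verts_window M A ha)).2
      exact mem_filter.2 ⟨mem_univ a, e, hE₀E he, hae⟩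
    have hJW : J ⊆ W := fun a ha => hAW (by rw [hA]; exact mem_union_left _ ha)
    have hA'W : A'.1 ⊆ W := fun a ha => hAW (by rw [hA]; exact mem_union_right _ (mem_union_left _ ha))
    have hA''W : A''.1 ⊆ W := fun a ha => hAW (by rw [hA]; exact mem_union_right _ (mem_union_right _ ha))
    have hWcard : W.card ≤ 2 * k := by rw [← hEcard]; exact card_window_le M.2 hEM
    -- the junta property of the containment indicators on `W`
    have hindW : ∀ (B : {A' : Finset (Fin n) // A'.card ≤ d}), B.1 ⊆ W → ∀ U U' : Finset (Fin n), U ∩ W = U' ∩ W → ind U B = ind U' B := by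
      intro B hB U U' hUU'
      have hiff : B.1 ⊆ U ↔ B.1 ⊆ U' := by
        constructor
        · intro h x hx
          have : x ∈ U ∩ W := mem_inter.2 ⟨h hx, hB hx⟩
          rw [hUU'] at this; exact (mem_inter.1 this).1
        · intro h x hx
          have : x ∈ U' ∩ W := mem_inter.2 ⟨h hx, hB hx⟩
          rw [← hUU'] at this; exact (mem_inter.1 this).1
      rw [hind]; dsimp only
      simp only [hiff]
    obtain ⟨P, hPdeg, -, hPval, hPsm⟩ := junta_sum_law_smooth M.2 hEM (t := t) (by rw [hEcard]; omega)
      (by rw [hEcard, hN]; omega) (by rw [hN]; omega) (Gab A' A'')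
      (fun B => if h : ∃ U : OddSet n, U.1.card = t ∧ U.1 ∩ W = B then Gab A' A'' h.choose.1 else 0)
      (fun U' _ hU't => by
        have hodd : Odd U'.card := hU't ▸ ht
        have hex : ∃ U : OddSet n, U.1.card = t ∧ U.1 ∩ W = U' ∩ W := ⟨⟨U', hodd⟩, hU't, rfl⟩
        rw [← hW, dif_pos hex]
        have h2 := hex.choose_spec.2
        have hodd' : Odd hex.choose.1.card := hex.choose.2
        rw [hGab]; dsimp only
        rw [dif_pos hodd, dif_pos hodd']
        have hJeq : U' ∩ J = hex.choose.1 ∩ J := by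
          calc U' ∩ J = (U' ∩ W) ∩ J := by rw [inter_assoc, inter_eq_right.2 hJW]
            _ = (hex.choose.1 ∩ W) ∩ J := by rw [h2]
            _ = hex.choose.1 ∩ J := by rw [inter_assoc, inter_eq_right.2 hJW]
        rw [hf ⟨U', hodd⟩ ⟨hex.choose.1, hodd'⟩ hJeq, hindW A' hA'W U' hex.choose.1 h2.symm, hindW A'' hA''W U' hex.choose.1 h2.symm])
      (fun B => by
        split_ifs with h
        · rw [hGab]; dsimp only
          split_ifs
          · refine mul_nonneg (hf0 _) (mul_nonneg ?_ ?_) <;> (rw [hind]; dsimp only; positivity)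
          · exact le_refl _
        · exact le_refl _)
      (Λmax := Λf) (fun B => by
        split_ifs with h
        · rw [hGab]; dsimp only
          split_ifs
          · have h1 : ind h.choose.1 A' * ind h.choose.1 A'' ≤ 1 := by
              rw [hind]; dsimp only; split_ifs <;> norm_num
            have h2 : 0 ≤ ind h.choose.1 A' * ind h.choose.1 A'' := by
              rw [hind]; dsimp only; positivity
            calc f _ * (ind h.choose.1 A' * ind h.choose.1 A'') ≤ Λf * 1 := mul_le_mul (hfΛ _) h1 h2 hΛf
              _ = Λf := mul_one _
          · exact hΛf
        · exact hΛf)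
    refine ⟨P, by rw [← hEcard]; exact hPdeg, fun c i hci => by rw [← hN]; exact hPval c i hci, fun m ξ hξ0 hξN => ?_⟩
    have h1 := hPsm m ξ hξ0 (by rw [hN]; exact hξN)
    rw [hEcard, hN, ← hW] at h1
    refine h1.trans ?_
    have h4 : (2 : ℝ) ^ W.card ≤ (4 : ℝ) ^ k := by
      calc (2 : ℝ) ^ W.card ≤ (2 : ℝ) ^ (2 * k) := pow_le_pow_right₀ (by norm_num) hWcard
        _ = (4 : ℝ) ^ k := by rw [pow_mul]; norm_num
    exact mul_le_mul_of_nonneg_right (mul_le_mul_of_nonneg_left h4 hΛf) (by positivity)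
  choose Pab hPabdeg hPabval hPabsm using hpat
  set Pt : Polynomial ℝ := ∑ A', ∑ A'', Polynomial.C (α A' * α A'') * Pab A' A'' with hPt
  have hPtdeg : Pt.natDegree ≤ k := by
    refine natDegree_sum_le_of_forall_le _ _ fun A' _ => natDegree_sum_le_of_forall_le _ _ fun A'' _ => ?_
    exact (natDegree_C_mul_le _ _).trans (hPabdeg A' A'')
  have hPtval : ∀ c i : ℕ, c + 2 * i = t →
      ∑ U ∈ (univ : Finset (Fin n)).powerset.filter (fun U =>
          (M.1.filter fun e => cutCount U e = 1).card = c ∧ (M.1.filter fun e => cutCount U e = 2).card = i), G U =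
        ((N.choose (c + i) * (c + i).choose i * 2 ^ c : ℕ) : ℝ) * Pt.eval (c : ℝ) := by
    intro c i hci
    rw [sum_congr rfl fun U _ => hGsum U, sum_comm, hPt, eval_finsetSum, mul_sum]
    refine sum_congr rfl fun A' _ => ?_
    rw [sum_comm, eval_finsetSum, mul_sum]
    refine sum_congr rfl fun A'' _ => ?_
    rw [← mul_sum, hPabval A' A'' c i hci, eval_mul, eval_C]
    ring
  have hPtsm : ∀ (m : ℕ) (ξ : ℝ), 0 ≤ ξ → ξ ≤ (N : ℝ) →
      |(derivative^[m] Pt).eval ξ| ≤ (∑ A', |α A'|) ^ 2 * Λf * (4 : ℝ) ^ k *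
        (((k.choose m : ℕ) : ℝ) * (m.factorial : ℝ) * (N : ℝ) ^ (k - m) / (N.descFactorial k : ℝ)) := by
    intro m ξ hξ0 hξN
    set R : ℝ := Λf * (4 : ℝ) ^ k * (((k.choose m : ℕ) : ℝ) * (m.factorial : ℝ) * (N : ℝ) ^ (k - m) / (N.descFactorial k : ℝ)) with hR
    have hR0 : 0 ≤ R := by rw [hR]; positivity
    rw [hPt, iterate_derivative_sum, eval_finsetSum]
    calc |∑ A', (derivative^[m] (∑ A'', Polynomial.C (α A' * α A'') * Pab A' A'')).eval ξ|
        ≤ ∑ A', |(derivative^[m] (∑ A'', Polynomial.C (α A' * α A'') * Pab A' A'')).eval ξ| := abs_sum_le_sum_abs _ _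
      _ ≤ ∑ A', ∑ A'', |α A'| * |α A''| * R := sum_le_sum fun A' _ => by
          rw [iterate_derivative_sum, eval_finsetSum]
          refine (abs_sum_le_sum_abs _ _).trans (sum_le_sum fun A'' _ => ?_)
          rw [iterate_derivative_C_mul, eval_mul, eval_C, abs_mul, abs_mul]
          exact mul_le_mul_of_nonneg_left (hPabsm A' A'' m ξ hξ0 hξN) (by positivity)
      _ = (∑ A', |α A'|) ^ 2 * R := by rw [sq, sum_mul_sum, sum_mul]; exact sum_congr rfl fun A' _ => by rw [sum_mul]
      _ = _ := by rw [hR]; ring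
  -- STEP B: nonnegative virtual value from the sharp half-degree law
  obtain ⟨L, g, hg, hfg⟩ := exists_sos_of_nonneg_junta J f hf hf0
  have hqlow : (fun U : OddSet n => qF U.1) ∈ Submodule.span ℝ (Set.range fun A' : {A' : Finset (Fin n) // A'.card ≤ d} =>
      fun U : OddSet n => if A'.1 ⊆ U.1 then (1 : ℝ) else 0) := by
    have e : (fun U : OddSet n => qF U.1) = ∑ A', α A' • (fun U : OddSet n => if A'.1 ⊆ U.1 then (1 : ℝ) else 0) := by
      funext U
      rw [hqF]; simp only [Finset.sum_apply, Pi.smul_apply, smul_eq_mul]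
      rfl
    rw [e]
    exact Submodule.sum_mem _ fun A' _ => Submodule.smul_mem _ _ (Submodule.subset_span ⟨A', rfl⟩)
  have hlow : ∀ l, (fun U : OddSet n => g l U * qF U.1) ∈ Submodule.span ℝ (Set.range fun A' : {A' : Finset (Fin n) // A'.card ≤ J.card + d} =>
      fun U : OddSet n => if A'.1 ⊆ U.1 then (1 : ℝ) else 0) := fun l => mul_mem_lowSpan (hg l) hqlow
  have hα' : ∀ l, ∃ cα : {A' : Finset (Fin n) // A'.card ≤ J.card + d} → ℝ,
      ∑ A', cα A' • (fun U : OddSet n => if A'.1 ⊆ U.1 then (1 : ℝ) else 0) = fun U => g l U * qF U.1 :=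
    fun l => (Submodule.mem_span_range_iff_exists_fun ℝ).1 (hlow l)
  choose β hβ using hα'
  have hβeval : ∀ (U : OddSet n) l, g l U * qF U.1 =
      ∑ A' : {A' : Finset (Fin n) // A'.card ≤ J.card + d}, β l A' * (if A'.1 ⊆ U.1 then (1 : ℝ) else 0) := by
    intro U l
    have := congrFun (hβ l) U
    rw [Finset.sum_apply] at this
    rw [← this]
    exact sum_congr rfl fun A' _ => by rw [Pi.smul_apply, smul_eq_mul]
  have hkM : 2 * (J.card + d) ≤ M.1.card := by rw [hN]; omega
  have hr₁ : ((J.card + d : ℕ) : ℝ) - 1 < (t : ℝ) / 2 := by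
    have : (2 : ℝ) * ((J.card + d : ℕ) : ℝ) + 1 ≤ t := by exact_mod_cast (show 2 * (J.card + d) + 1 ≤ t by omega)
    linarith
  have hr₂ : (t : ℝ) / 2 < (M.1.card : ℝ) - ((J.card + d : ℕ) : ℝ) + 1 := by
    rw [hN]
    have h1 : (2 : ℝ) * ((J.card + d : ℕ) : ℝ) + 1 ≤ t := by exact_mod_cast (show 2 * (J.card + d) + 1 ≤ t by omega)
    have h2 : (t : ℝ) ≤ N := by exact_mod_cast htN
    linarith
  obtain ⟨Ps, hPsdeg, hPs0, hPsval⟩ := lowdeg_sum_law_sharp Grigoriev2001_knapsackFormNonneg_holds M hkM hr₁ hr₂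
    (fun (_ : Fin 1) (l : Fin L) A' => β l A') (1 : Matrix (Fin 1) (Fin 1) ℝ) Matrix.PosSemidef.one
  have hPsval' : ∀ c i : ℕ, c + 2 * i = t →
      ∑ U ∈ (univ : Finset (Fin n)).powerset.filter (fun U =>
          (M.1.filter fun e => cutCount U e = 1).card = c ∧ (M.1.filter fun e => cutCount U e = 2).card = i), G U =
        ((N.choose (c + i) * (c + i).choose i * 2 ^ c : ℕ) : ℝ) * Ps.eval (c : ℝ) := by
    intro c i hci
    rw [← hN, ← hPsval c i hci]
    refine sum_congr rfl fun U' hU' => ?_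
    have hodd : Odd U'.card := by
      obtain ⟨-, hc, hi⟩ := mem_filter.1 hU'
      have h := card_eq_cr_add_two_mul_in M.2 (subset_univ U')
      rw [hc, hi, hci] at h
      exact h ▸ ht
    rw [hG]; dsimp only
    rw [dif_pos hodd, hfg ⟨U', hodd⟩, sum_mul]
    simp only [Fin.sum_univ_one, Matrix.one_apply_eq, one_mul]
    refine sum_congr rfl fun l _ => ?_
    rw [← hβeval ⟨U', hodd⟩ l]
    ring
  -- STEP C: uniqueness
  have hPtPs : Pt = Ps := levelLaw_unique ht htN (by omega) _ hPtdeg (hPsdeg.trans (by omega)) hPtval hPsval'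
  refine ⟨Pt, hPtdeg, by rw [hPtPs]; exact hPs0, hPtval, hPtsm⟩

/-! ### §2 Design consequences: per matching, and summed with matching-adapted squares -/

/-- **JUNTA MASKS TIMES LOW-DEGREE SQUARES ARE PRICED PER MATCHING BEYOND THE DESIGN DEGREE.** For an exact design `(n,t,T,D,B_v,C,w)`, a matching
`M`, a nonnegative `J`-junta mask `f ≤ Λ_f`, and ANY `q = Σ_{|A'|≤d} α_{A'}1[A' ⊆ ·]` with `2(|J|+2d)+1 ≤ t`:
`Σ_U W(U,M)·f(U)·q(U)² ≤ |PM|⁻¹·B_v·C(T,D+1)·(Σ|α|)²·Λ_f·4^k·C(k,D+1)(D+1)!·N^{k−D−1}/[N]_k`, `k = |J| + 2d` — the (CG_d) cell «junta ⊗ degree-`d` square» at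
every matching, zero for `k ≤ D`. [cite: Grigoriev2001, Lemma 1.4 (PDF p. 8)] [cite: Rothvoss2017, §2 (PDF p. 6)] [cite: Agarwal2000DifferenceEquations, Remark 1.8.1 (1.8.8)] -/
theorem juntaTimesSquare_le_single {t T D : ℕ} {Bv : ℝ} {C : Finset ℕ} {w : ℕ → ℝ} (hdes : IsExactDesign n t T D Bv C w)
    (M : PMatch n) (J : Finset (Fin n)) {d : ℕ} (hJt : 2 * (J.card + 2 * d) + 1 ≤ t)
    (f : OddSet n → ℝ) (hf : ∀ U U' : OddSet n, U.1 ∩ J = U'.1 ∩ J → f U = f U') {Λf : ℝ} (hf0 : ∀ U, 0 ≤ f U) (hfΛ : ∀ U, f U ≤ Λf)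
    (α : {A' : Finset (Fin n) // A'.card ≤ d} → ℝ) :
    ∑ U : OddSet n, levelWeight n t C w U M *
        (f U * (∑ A' : {A' : Finset (Fin n) // A'.card ≤ d}, α A' * (if A'.1 ⊆ U.1 then (1 : ℝ) else 0)) ^ 2) ≤
      (Fintype.card (PMatch n) : ℝ)⁻¹ * (Bv * ((T.choose (D + 1) : ℕ) : ℝ) * ((∑ A', |α A'|) ^ 2 * Λf * (4 : ℝ) ^ (J.card + 2 * d) *
        ((((J.card + 2 * d).choose (D + 1) : ℕ) : ℝ) * ((D + 1).factorial : ℝ) * (((n / 2 : ℕ) : ℝ)) ^ (J.card + 2 * d - (D + 1)) /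
          ((n / 2).descFactorial (J.card + 2 * d) : ℝ)))) := by
  have ht : Odd t := hdes.1
  have htn : 2 * t + 2 ≤ n := hdes.2.1
  obtain ⟨P, -, hP0, hPval, hPsm⟩ := juntaTimesSquare_levelLaw M ht htn J hJt f hf hf0 hfΛ α
  have hΛf : 0 ≤ Λf := by
    have hodd1 : Odd (({(⟨0, by omega⟩ : Fin n)} : Finset (Fin n)).card) := by simp
    exact (hf0 ⟨_, hodd1⟩).trans (hfΛ ⟨_, hodd1⟩)
  set K : ℝ := (∑ A', |α A'|) ^ 2 * Λf * (4 : ℝ) ^ (J.card + 2 * d) *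
    ((((J.card + 2 * d).choose (D + 1) : ℕ) : ℝ) * ((D + 1).factorial : ℝ) * (((n / 2 : ℕ) : ℝ)) ^ (J.card + 2 * d - (D + 1)) /
      ((n / 2).descFactorial (J.card + 2 * d) : ℝ)) with hK
  have hK0 : 0 ≤ K := by rw [hK]; positivity
  have h := designValue_le_of_levelLaw hdes M
    (fun U => f U * (∑ A' : {A' : Finset (Fin n) // A'.card ≤ d}, α A' * (if A'.1 ⊆ U.1 then (1 : ℝ) else 0)) ^ 2)
    P (fun c i hci => by rw [← hPval c i hci]) hK0 (fun ξ h0 h1 => hPsm (D + 1) ξ h0 h1)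
  refine h.trans (mul_le_mul_of_nonneg_left ?_ (inv_nonneg.2 (Nat.cast_nonneg _)))
  linarith

/-- **Summed over the matchings with matching-adapted squares** (`α_M` of coefficient mass `Σ|α_M| ≤ Λ_α`, power form, `N = n/2`):
`Σ_M (Σ_U W(U,M) f(U) q_M(U)²)₊ ≤ B_v·C(T,D+1)·Λ_α²Λ_f·8^k·C(k,D+1)(D+1)!/N^{D+1}`, `k = |J|+2d` — super-polynomially small in the balanced Chebyshev regime for
`k = O(dq n)`: the whole (CG_d)-hierarchy (MEMO-21 §3) holds on junta masks. [cite: Grigoriev2001, Lemma 1.4 (PDF p. 8)] [cite: Rothvoss2017, §2 (PDF p. 6)]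
[cite: GriblingDelaatLaurent2019, §5] -/
theorem sum_posPart_juntaTimesSquare_le {t T D : ℕ} {Bv : ℝ} {C : Finset ℕ} {w : ℕ → ℝ} (hdes : IsExactDesign n t T D Bv C w)
    (J : Finset (Fin n)) {d : ℕ} (hJt : 2 * (J.card + 2 * d) + 1 ≤ t)
    (f : OddSet n → ℝ) (hf : ∀ U U' : OddSet n, U.1 ∩ J = U'.1 ∩ J → f U = f U') {Λf : ℝ} (hf0 : ∀ U, 0 ≤ f U) (hfΛ : ∀ U, f U ≤ Λf)
    (α : PMatch n → {A' : Finset (Fin n) // A'.card ≤ d} → ℝ) {Λα : ℝ} (hα : ∀ M, ∑ A', |α M A'| ≤ Λα) :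
    ∑ M : PMatch n, max (∑ U : OddSet n, levelWeight n t C w U M *
        (f U * (∑ A' : {A' : Finset (Fin n) // A'.card ≤ d}, α M A' * (if A'.1 ⊆ U.1 then (1 : ℝ) else 0)) ^ 2)) 0 ≤
      Bv * ((T.choose (D + 1) : ℕ) : ℝ) * (Λα ^ 2 * Λf * (8 : ℝ) ^ (J.card + 2 * d) *
        ((((J.card + 2 * d).choose (D + 1) : ℕ) : ℝ) * ((D + 1).factorial : ℝ) / (((n / 2 : ℕ) : ℝ)) ^ (D + 1))) := by
  have ht : Odd t := hdes.1
  have htn : 2 * t + 2 ≤ n := hdes.2.1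
  have hB : 0 ≤ Bv := (sum_nonneg fun c _ => abs_nonneg (w c)).trans hdes.2.2.2.2.2.2
  have hΛf : 0 ≤ Λf := by
    have hodd1 : Odd (({(⟨0, by omega⟩ : Fin n)} : Finset (Fin n)).card) := by simp
    exact (hf0 ⟨_, hodd1⟩).trans (hfΛ ⟨_, hodd1⟩)
  set k := J.card + 2 * d with hk
  have hNpos : 0 < n / 2 := by omega
  have hkN : 2 * k ≤ n / 2 := by omega
  -- `OddSet`/`PMatch` nonempty ⇒ `0 ≤ Λα`
  obtain ⟨c₀, hc₀⟩ := nonempty_of_exact hdes.exact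
  obtain ⟨q₀, _⟩ := (hdes.2.2.2.1 c₀ hc₀).2.2.2
  have hΛα : 0 ≤ Λα := (sum_nonneg fun A' _ => abs_nonneg _).trans (hα q₀.2)
  set X : ℝ := Bv * ((T.choose (D + 1) : ℕ) : ℝ) * (Λα ^ 2 * Λf * (8 : ℝ) ^ k *
    (((k.choose (D + 1) : ℕ) : ℝ) * ((D + 1).factorial : ℝ) / (((n / 2 : ℕ) : ℝ)) ^ (D + 1))) with hX
  have hX0 : 0 ≤ X := by rw [hX]; positivity
  have hKX : ∀ M : PMatch n, Bv * ((T.choose (D + 1) : ℕ) : ℝ) * ((∑ A', |α M A'|) ^ 2 * Λf * (4 : ℝ) ^ k *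
      (((k.choose (D + 1) : ℕ) : ℝ) * ((D + 1).factorial : ℝ) * (((n / 2 : ℕ) : ℝ)) ^ (k - (D + 1)) / ((n / 2).descFactorial k : ℝ))) ≤ X := by
    intro M
    rw [hX]
    refine mul_le_mul_of_nonneg_left ?_ (by positivity)
    have hv2 : (∑ A', |α M A'|) ^ 2 ≤ Λα ^ 2 := pow_le_pow_left₀ (sum_nonneg fun _ _ => abs_nonneg _) (hα M) 2
    rcases le_or_gt (D + 1) k with hle | hlt
    · have key := pow_div_descFactorial_le hNpos hkN hle
      have h8 : (4 : ℝ) ^ k * (2 : ℝ) ^ k = (8 : ℝ) ^ k := by rw [← mul_pow]; norm_num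
      calc (∑ A', |α M A'|) ^ 2 * Λf * (4 : ℝ) ^ k *
            (((k.choose (D + 1) : ℕ) : ℝ) * ((D + 1).factorial : ℝ) * (((n / 2 : ℕ) : ℝ)) ^ (k - (D + 1)) / ((n / 2).descFactorial k : ℝ))
          = (∑ A', |α M A'|) ^ 2 * Λf * (4 : ℝ) ^ k * (((k.choose (D + 1) : ℕ) : ℝ) * ((D + 1).factorial : ℝ)) *
              ((((n / 2 : ℕ) : ℝ)) ^ (k - (D + 1)) / ((n / 2).descFactorial k : ℝ)) := by ring
        _ ≤ Λα ^ 2 * Λf * (4 : ℝ) ^ k * (((k.choose (D + 1) : ℕ) : ℝ) * ((D + 1).factorial : ℝ)) *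
              ((2 : ℝ) ^ k / (((n / 2 : ℕ) : ℝ)) ^ (D + 1)) := by
            refine mul_le_mul ?_ key (by positivity) (by positivity)
            exact mul_le_mul_of_nonneg_right (mul_le_mul_of_nonneg_right (mul_le_mul_of_nonneg_right hv2 hΛf) (by positivity))
              (by positivity)
        _ = Λα ^ 2 * Λf * (8 : ℝ) ^ k * (((k.choose (D + 1) : ℕ) : ℝ) * ((D + 1).factorial : ℝ) / (((n / 2 : ℕ) : ℝ)) ^ (D + 1)) := by
            rw [← h8]; ring
    · rw [Nat.choose_eq_zero_of_lt hlt]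
      simp only [Nat.cast_zero, zero_mul, zero_div, mul_zero]
      positivity
  have hper : ∀ M : PMatch n, max (∑ U : OddSet n, levelWeight n t C w U M *
      (f U * (∑ A' : {A' : Finset (Fin n) // A'.card ≤ d}, α M A' * (if A'.1 ⊆ U.1 then (1 : ℝ) else 0)) ^ 2)) 0 ≤
      (Fintype.card (PMatch n) : ℝ)⁻¹ * X := by
    intro M
    refine max_le ?_ (by positivity)
    exact (juntaTimesSquare_le_single hdes M J hJt f hf hf0 hfΛ (α M)).trans
      (mul_le_mul_of_nonneg_left (hKX M) (inv_nonneg.2 (Nat.cast_nonneg _)))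
  calc ∑ M : PMatch n, max (∑ U : OddSet n, levelWeight n t C w U M *
        (f U * (∑ A' : {A' : Finset (Fin n) // A'.card ≤ d}, α M A' * (if A'.1 ⊆ U.1 then (1 : ℝ) else 0)) ^ 2)) 0
      ≤ ∑ _M : PMatch n, (Fintype.card (PMatch n) : ℝ)⁻¹ * X := sum_le_sum fun M _ => hper M
    _ ≤ X := by
        rw [sum_const, card_univ, nsmul_eq_mul]
        rcases eq_or_ne (Fintype.card (PMatch n) : ℝ) 0 with h0 | h0
        · rw [h0]; simp [hX0]
        · rw [← mul_assoc, mul_inv_cancel₀ h0, one_mul]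

end Summit.PneNP.PneNP.Theorems.ChebyshevTracialDesignJuntaTimesSquare
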